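import Summits.ResolutionOfSingularities.ResolutionOfSingularities.Theorems.MarkedTransferCampaignW46ExitTreeTransport
import Literature.RingTheory.RegularLocalRing.QuotientDVR
import Mathlib.RingTheory.Localization.FractionRing
import Mathlib.RingTheory.DiscreteValuationRing.Basic
import HarnessLib

/-!
# The germ invariant `ν(R, I, b)` of an abstract local ring: the exit count read in the fraction field, and
# the curve case

[OURS · L1 W4.6 rung (i-a)′, INVARIANT layer — cell res-hironaka, LADDER-RESOLUTION rung L, D-0089; campaign s46,
seat res-D-pv-044 AS res-L1-s46-pv-8; host route MarkedTransfer, `--supports stmt-ResolutionOfSingularities-16156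
--as helper`.] HONEST FRAMING: nothing here is a statement of H. Hironaka's manuscript (2017-03-23, [Hironaka2017]);
pure commutative algebra, continuing `MarkedTransferCampaignW46ExitTree{,Transport}.lean`. AI-written; weaker than
expert review. No `sorry`; axioms standard.

res-L1-s46-pv-9's glue `planeIsolatedFinLocalExitBound_of_germLocal` (p498215) wants ONE invariant
`ν : ∀ (R : Type u) [CommRing R], Ideal R → ℕ → ℕ`, invariant under ring isomorphisms, evaluated at the stalks
`(𝒪_{Z,ξ}, J_ξ, b)`. This file defines it and proves the two facts the dictionary consumes:

* `curveOrder R I` — the exact `𝔪`-adic order of an ideal of a local ring (`Nat.find`; junk `0` for `I ⊆ ⋂ 𝔪^k`);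
  `curveOrder_colon_lt` — **the curve case of the centre inequality**: in a discrete valuation ring, for
  `0 ≠ I ⊆ 𝔪^b`, `b ≥ 1`, the controlled transform `(I : 𝔪^b)` has strictly smaller order;
* `domainExitCount`, **`germExitCount R I b`** := `curveOrder R I` if `R` is a regular local ring of dimension
  `1`, else (for a domain) the exit count `exitCount b R I` of the marked quadratic tree read in `Frac R`
  (`…ExitTree.lean`), else `0`;
* `germExitCount_eq_exitCount` — **for a domain `R` of dimension `≠ 1` and ANY injective `f : R →+* K` into a
  field exhibiting `K` as the field of fractions of `f(R)`, `germExitCount R I b = exitCount b f(R) f(I)`** (so the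
  dictionary may compute `ν` inside the function field `K(Z)`), via the transport `exitCount_map_ringEquiv`;
* `germExitCount_map_ringEquiv` — **ring-isomorphism invariance** `ν(R', e(I), b) = ν(R, I, b)`.

## References

* O. Zariski, P. Samuel, *Commutative Algebra* II (1960), Appendix 5. [ZariskiSamuel1960]
-/

noncomputable section

open IsLocalRing

-- single-problem summit: the doubled namespace component `ResolutionOfSingularities` is forced
set_option linter.dupNamespace false

namespace Summit.ResolutionOfSingularities.ResolutionOfSingularities.Theorems.CampaignW46

open Literature.AlgebraicGeometry.Resolution

universe u

/-! ## The exact order of an ideal of a local ring -/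

section CurveOrder

variable {R : Type u} [CommRing R] [IsLocalRing R]

open Classical in
/-- **The exact `𝔪`-adic order** of the ideal `I` of the local ring `R`: the `r` with `I ⊆ 𝔪^r`, `I ⊄ 𝔪^{r+1}`
(junk value `0` when `I ⊆ 𝔪^k` for every `k`, e.g. `I = 0`). [folklore] -/
def curveOrder (R : Type u) [CommRing R] [IsLocalRing R] (I : Ideal R) : ℕ :=
  if h : ∃ k, ¬ I ≤ maximalIdeal R ^ (k + 1) then Nat.find h else 0

/-- `I ⊄ 𝔪^{r+1}` for the exact order `r`. [folklore] -/
theorem not_le_pow_curveOrder_succ {I : Ideal R} (h : ∃ k, ¬ I ≤ maximalIdeal R ^ (k + 1)) :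
    ¬ I ≤ maximalIdeal R ^ (curveOrder R I + 1) := by
  classical
  rw [curveOrder, dif_pos h]
  exact Nat.find_spec h

/-- `I ⊆ 𝔪^r` for the exact order `r`. [folklore] -/
theorem le_pow_curveOrder (I : Ideal R) : I ≤ maximalIdeal R ^ curveOrder R I := by
  classical
  by_cases h : ∃ k, ¬ I ≤ maximalIdeal R ^ (k + 1)
  · rw [curveOrder, dif_pos h]
    rcases Nat.eq_zero_or_pos (Nat.find h) with h0 | hpos
    · rw [h0, pow_zero, Ideal.one_eq_top]; exact le_top
    · have := Nat.find_min h (show Nat.find h - 1 < Nat.find h by omega)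
      push Not at this
      rwa [show Nat.find h - 1 + 1 = Nat.find h by omega] at this
  · rw [curveOrder, dif_neg h, pow_zero, Ideal.one_eq_top]; exact le_top

/-- The exact order is determined by the predicate `I ⊆ 𝔪^k`: ideals of two local rings with the same such
predicate have the same order. [folklore] -/
theorem curveOrder_eq_of_iff {R' : Type u} [CommRing R'] [IsLocalRing R'] {I : Ideal R} {I' : Ideal R'}
    (h : ∀ k, I ≤ maximalIdeal R ^ k ↔ I' ≤ maximalIdeal R' ^ k) : curveOrder R I = curveOrder R' I' := by
  classical
  by_cases hex : ∃ k, ¬ I ≤ maximalIdeal R ^ (k + 1)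
  · have hex' : ∃ k, ¬ I' ≤ maximalIdeal R' ^ (k + 1) := by
      obtain ⟨k, hk⟩ := hex
      exact ⟨k, fun hle => hk ((h _).mpr hle)⟩
    rw [curveOrder, curveOrder, dif_pos hex, dif_pos hex', Nat.find_eq_iff]
    refine ⟨fun hle => Nat.find_spec hex' ((h _).mp hle), fun n hn hle => ?_⟩
    exact Nat.find_min hex' hn fun hle' => hle ((h _).mpr hle')
  · have hex' : ¬ ∃ k, ¬ I' ≤ maximalIdeal R' ^ (k + 1) := by
      rintro ⟨k, hk⟩
      exact hex ⟨k, fun hle => hk ((h _).mp hle)⟩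
    rw [curveOrder, curveOrder, dif_neg hex, dif_neg hex']

/-- The exact order is invariant under ring isomorphisms. [folklore] -/
theorem curveOrder_map_ringEquiv {R' : Type u} [CommRing R'] [IsLocalRing R'] (e : R ≃+* R') (I : Ideal R) :
    curveOrder R' (I.map e) = curveOrder R I := by
  refine (curveOrder_eq_of_iff fun k => ?_).symm
  rw [← IsLocalRing.map_ringEquiv_maximalIdeal e, ← Ideal.map_pow]
  constructor
  · exact fun hle => Ideal.map_mono hle
  · intro hle
    have := Ideal.map_mono (f := e.symm) hle
    rwa [map_map_symm_of_equiv, map_map_symm_of_equiv] at this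

end CurveOrder

/-! ## The curve case: in a discrete valuation ring the controlled transform has smaller order -/

section DVR

variable {R : Type u} [CommRing R] [IsDomain R] [IsDiscreteValuationRing R]

/-- `(ϖⁿ) ⊆ 𝔪^k ↔ k ≤ n` for a uniformizer `ϖ`. [folklore] -/
theorem span_pow_le_pow_maximalIdeal_iff {ϖ : R} (hϖ : Irreducible ϖ) (n k : ℕ) :
    Ideal.span {ϖ ^ n} ≤ maximalIdeal R ^ k ↔ k ≤ n := by
  rw [hϖ.maximalIdeal_eq, Ideal.span_singleton_pow, Ideal.span_singleton_le_span_singleton,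
    pow_dvd_pow_iff hϖ.ne_zero hϖ.not_isUnit]

/-- The exact order of `(ϖⁿ)` is `n`. [folklore] -/
theorem curveOrder_span_pow {ϖ : R} (hϖ : Irreducible ϖ) (n : ℕ) :
    curveOrder R (Ideal.span {ϖ ^ n}) = n := by
  classical
  have hex : ∃ k, ¬ Ideal.span {ϖ ^ n} ≤ maximalIdeal R ^ (k + 1) :=
    ⟨n, by rw [span_pow_le_pow_maximalIdeal_iff hϖ]; omega⟩
  rw [curveOrder, dif_pos hex, Nat.find_eq_iff]
  refine ⟨by rw [span_pow_le_pow_maximalIdeal_iff hϖ]; omega, fun k hk hle => hle ?_⟩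
  rw [span_pow_le_pow_maximalIdeal_iff hϖ]
  omega

/-- `((ϖⁿ) : 𝔪^b) = (ϖ^{n-b})` for `b ≤ n`. [folklore] -/
theorem colon_span_pow_eq {ϖ : R} (hϖ : Irreducible ϖ) {n b : ℕ} (hbn : b ≤ n) :
    Submodule.colon (Ideal.span {ϖ ^ n}) ((maximalIdeal R ^ b : Ideal R) : Set R) =
      Ideal.span {ϖ ^ (n - b)} := by
  obtain ⟨m, rfl⟩ : ∃ m, n = b + m := ⟨n - b, by omega⟩
  rw [show b + m - b = m by omega, hϖ.maximalIdeal_eq, Ideal.span_singleton_pow, pow_add]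
  ext x
  rw [Submodule.mem_colon, Ideal.mem_span_singleton]
  constructor
  · intro h
    have hx := h (ϖ ^ b) (Ideal.mem_span_singleton_self _)
    rw [smul_eq_mul, Ideal.mem_span_singleton] at hx
    obtain ⟨c, hc⟩ := hx
    refine ⟨c, mul_right_cancel₀ (pow_ne_zero b hϖ.ne_zero) ?_⟩
    rw [hc]
    ring
  · rintro ⟨c, rfl⟩ s hs
    rw [SetLike.mem_coe, Ideal.mem_span_singleton] at hs
    obtain ⟨d, rfl⟩ := hs
    rw [smul_eq_mul, Ideal.mem_span_singleton]
    exact ⟨c * d, by ring⟩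

/-- **The curve case of the centre inequality.** In a discrete valuation ring, for an ideal `0 ≠ I ⊆ 𝔪^b` with
`b ≥ 1`, the controlled transform `(I : 𝔪^b)` has strictly smaller exact order (`ord I - b < ord I`): along a
regular curve the order-`b` reduction of `(J, b)` blows up each point at most `ord/b` times. [folklore] -/
theorem curveOrder_colon_lt {I : Ideal R} (hI0 : I ≠ ⊥) {b : ℕ} (hb : 0 < b)
    (hIb : I ≤ maximalIdeal R ^ b) :
    curveOrder R (Submodule.colon I ((maximalIdeal R ^ b : Ideal R) : Set R)) < curveOrder R I := by
  obtain ⟨ϖ, hϖ⟩ := IsDiscreteValuationRing.exists_irreducible R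
  obtain ⟨n, rfl⟩ := IsDiscreteValuationRing.ideal_eq_span_pow_irreducible hI0 hϖ
  have hbn : b ≤ n := (span_pow_le_pow_maximalIdeal_iff hϖ n b).mp hIb
  rw [colon_span_pow_eq hϖ hbn, curveOrder_span_pow hϖ, curveOrder_span_pow hϖ]
  omega

end DVR

/-! ## The germ invariant of an abstract ring -/

section Germ

/-- The exit count of `(R, I, b)` read in the fraction field of the domain `R`: the marked quadratic tree of the
image of `I` in the subring `R ⊆ Frac R`. [folklore] -/
def domainExitCount (R : Type u) [CommRing R] [IsDomain R] (I : Ideal R) (b : ℕ) : ℕ :=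
  exitCount b (algebraMap R (FractionRing R)).range (I.map (algebraMap R (FractionRing R)).rangeRestrict)

open Classical in
/-- **The germ invariant `ν(R, I, b)`** (the `β` of rung (i-a)′, evaluated by res-L1-s46-pv-9's glue at the stalk
`(𝒪_{Z,ξ}, J_ξ, b)`): for a regular local ring of dimension `1` the exact order of `I`; otherwise, for a domain,
the exit count of the marked quadratic tree of `(R, I, b)` in `Frac R`; `0` else (junk). [folklore] -/
def germExitCount (R : Type u) [CommRing R] (I : Ideal R) (b : ℕ) : ℕ :=
  if h : IsRegularLocalRing R ∧ ringKrullDim R = 1 then @curveOrder R _ h.1.toIsLocalRing I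
  else if hd : IsDomain R then @domainExitCount R _ hd I b else 0

/-- The curve branch. [folklore] -/
theorem germExitCount_eq_curveOrder {R : Type u} [CommRing R] [hR : IsRegularLocalRing R]
    (h1 : ringKrullDim R = 1) (I : Ideal R) (b : ℕ) : germExitCount R I b = curveOrder R I := by
  classical
  rw [germExitCount, dif_pos ⟨hR, h1⟩]

/-- The surface branch, in `Frac R`. [folklore] -/
theorem germExitCount_eq_domainExitCount {R : Type u} [CommRing R] [hd : IsDomain R]
    (h1 : ¬ (IsRegularLocalRing R ∧ ringKrullDim R = 1)) (I : Ideal R) (b : ℕ) :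
    germExitCount R I b = domainExitCount R I b := by
  classical
  rw [germExitCount, dif_neg h1, dif_pos hd]

/-- Exit counts of marked nodes with the same ring and the same image of the ideal agree (sigma bookkeeping).
[folklore] -/
theorem exitCount_congr {K : Type u} [Field K] {b : ℕ} {S S' : Subring K} {J : Ideal S} {J' : Ideal S'}
    (h1 : S = S') (h2 : ((↑) : S → K) '' (J : Set S) = ((↑) : S' → K) '' (J' : Set S')) :
    exitCount b S J = exitCount b S' J' := by
  have : (⟨S, J⟩ : MarkedNode K) = ⟨S', J'⟩ := MarkedNode.ext_of_image h1 h2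
  rw [exitCount, exitCount, this]

/-- The image in `K` of `I.map f.rangeRestrict` is `f(I)`. [folklore] -/
theorem coe_image_map_rangeRestrict {R K : Type u} [CommRing R] [Field K] (f : R →+* K) (I : Ideal R) :
    ((↑) : f.range → K) '' (I.map f.rangeRestrict : Set f.range) = f '' (I : Set R) := by
  ext w
  simp only [Set.mem_image, SetLike.mem_coe]
  constructor
  · rintro ⟨w', hw', rfl⟩
    obtain ⟨x, hx, rfl⟩ := (Ideal.mem_map_iff_of_surjective f.rangeRestrict
      (RingHom.rangeRestrict_surjective f)).mp hw'
    exact ⟨x, hx, rfl⟩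
  · rintro ⟨x, hx, rfl⟩
    exact ⟨f.rangeRestrict x, Ideal.mem_map_of_mem _ hx, rfl⟩

/-- **The germ invariant may be computed in ANY realisation of the fraction field**: for a domain `R` of
dimension `≠ 1` (or not regular local), an injective `f : R →+* K` into a field all of whose elements are fractions
of elements of `f(R)`, `ν(R, I, b) = exitCount b f(R) f(I)`. [folklore] -/
theorem germExitCount_eq_exitCount {R : Type u} [CommRing R] [IsDomain R]
    (h1 : ¬ (IsRegularLocalRing R ∧ ringKrullDim R = 1))
    {K : Type u} [Field K] (f : R →+* K) (hf : Function.Injective f)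
    (hfrac : ∀ z : K, ∃ a c : R, f c ≠ 0 ∧ z = f a / f c) (I : Ideal R) (b : ℕ) :
    germExitCount R I b = exitCount b f.range (I.map f.rangeRestrict) := by
  rw [germExitCount_eq_domainExitCount h1, domainExitCount]
  set F := FractionRing R with hF
  set ι : R →+* F := algebraMap R F with hι
  -- the isomorphism `Frac R ≃+* K` over `R`
  set φ₀ : F →+* K := IsFractionRing.lift hf with hφ₀
  have hφι : ∀ x, φ₀ (ι x) = f x := fun x => IsFractionRing.lift_algebraMap hf x
  have hbij : Function.Bijective φ₀ := by
    refine ⟨φ₀.injective, fun z => ?_⟩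
    obtain ⟨a, c, hc, rfl⟩ := hfrac z
    refine ⟨ι a / ι c, ?_⟩
    rw [map_div₀, hφι, hφι]
  set φ : F ≃+* K := RingEquiv.ofBijective φ₀ hbij with hφ
  have hφι' : ∀ x, φ (ι x) = f x := hφι
  rw [← exitCount_map_ringEquiv φ]
  refine exitCount_congr ?_ ?_
  · ext w
    constructor
    · intro hw
      obtain ⟨v, ⟨x, rfl⟩, rfl⟩ := Subring.mem_map.mp hw
      exact ⟨x, (hφι' x).symm⟩
    · rintro ⟨x, rfl⟩
      exact Subring.mem_map.mpr ⟨ι x, ⟨x, rfl⟩, hφι' x⟩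
  · rw [coe_image_map_subringMapEquiv, coe_image_map_rangeRestrict, coe_image_map_rangeRestrict,
      ← Set.image_comp]
    apply Set.image_congr
    intro x _
    exact hφι' x

/-- **Ring-isomorphism invariance of the germ invariant**: `ν(R', e(I), b) = ν(R, I, b)`. [folklore] -/
theorem germExitCount_map_ringEquiv {R R' : Type u} [CommRing R] [CommRing R'] (e : R ≃+* R') (I : Ideal R)
    (b : ℕ) : germExitCount R' (I.map e) b = germExitCount R I b := by
  classical
  have hdimeq : ringKrullDim R' = ringKrullDim R := (ringKrullDim_eq_of_ringEquiv e).symm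
  by_cases h : IsRegularLocalRing R ∧ ringKrullDim R = 1
  · haveI := h.1
    haveI : IsRegularLocalRing R' := IsRegularLocalRing.of_ringEquiv e
    rw [germExitCount_eq_curveOrder h.2, germExitCount_eq_curveOrder (hdimeq.trans h.2),
      curveOrder_map_ringEquiv]
  · have h' : ¬ (IsRegularLocalRing R' ∧ ringKrullDim R' = 1) := by
      rintro ⟨hreg', h1'⟩
      haveI := hreg'
      exact h ⟨IsRegularLocalRing.of_ringEquiv e.symm, hdimeq ▸ h1'⟩
    by_cases hd : IsDomain R
    · haveI := hd
      haveI : IsDomain R' := MulEquiv.isDomain R e.symm.toMulEquiv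
      set F' := FractionRing R' with hF'
      set f' : R' →+* F' := algebraMap R' F' with hf'
      have hf'inj : Function.Injective f' := IsFractionRing.injective R' F'
      have hfrac' : ∀ z : F', ∃ a c : R', f' c ≠ 0 ∧ z = f' a / f' c := fun z => by
        obtain ⟨a, c, hc, hz⟩ := IsFractionRing.div_surjective (A := R') z
        exact ⟨a, c, IsFractionRing.to_map_ne_zero_of_mem_nonZeroDivisors hc, hz.symm⟩
      set f : R →+* F' := f'.comp e.toRingHom with hf
      have hfinj : Function.Injective f := hf'inj.comp e.injective
      have hfrac : ∀ z : F', ∃ a c : R, f c ≠ 0 ∧ z = f a / f c := fun z => by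
        obtain ⟨a, c, hc, hz⟩ := hfrac' z
        refine ⟨e.symm a, e.symm c, ?_, ?_⟩
        · change f' (e.toRingHom (e.symm c)) ≠ 0
          rw [RingEquiv.toRingHom_eq_coe, RingEquiv.coe_toRingHom, e.apply_symm_apply]; exact hc
        · change z = f' (e.toRingHom (e.symm a)) / f' (e.toRingHom (e.symm c))
          rw [RingEquiv.toRingHom_eq_coe, RingEquiv.coe_toRingHom, e.apply_symm_apply, e.apply_symm_apply]
          exact hz
      rw [germExitCount_eq_exitCount h' f' hf'inj hfrac', germExitCount_eq_exitCount h f hfinj hfrac]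
      have hfe : ∀ x : R, f x = f' (e x) := fun _ => rfl
      refine exitCount_congr ?_ ?_
      · ext w
        constructor
        · rintro ⟨y, rfl⟩
          exact ⟨e.symm y, by rw [hfe, e.apply_symm_apply]⟩
        · rintro ⟨x, rfl⟩
          exact ⟨e x, (hfe x).symm⟩
      · rw [coe_image_map_rangeRestrict, coe_image_map_rangeRestrict]
        ext w
        simp only [Set.mem_image, SetLike.mem_coe]
        constructor
        · rintro ⟨y, hy, rfl⟩
          obtain ⟨x, hx, rfl⟩ := (Ideal.mem_map_of_equiv e y).mp hy
          exact ⟨x, hx, hfe x⟩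
        · rintro ⟨x, hx, rfl⟩
          exact ⟨e x, Ideal.mem_map_of_mem _ hx, (hfe x).symm⟩
    · have hd' : ¬ IsDomain R' := fun hd' => hd (by haveI := hd'; exact MulEquiv.isDomain R' e.toMulEquiv)
      rw [germExitCount, germExitCount, dif_neg h', dif_neg hd', dif_neg h, dif_neg hd]

end Germ

end Summit.ResolutionOfSingularities.ResolutionOfSingularities.Theorems.CampaignW46

end
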